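import Literature.Geometry.Kaehler.ComplexTorusHodgeGroupSpecialLinear
import Literature.Geometry.Kaehler.ComplexTorusHodgeGroupProductDual
import Literature.Geometry.Kaehler.ComplexTorusPicardNumberProduct
import HarnessLib

/-!
# `Hg(X) = SL(V)`, `g ≥ 2 ⟹ Hom_ℚ(X, X̂) = 0`: the general complex torus is not isogenous to its dual,
# and `X × X̂ ≁ X × X`

`[topic Geometry/Kaehler]` — a short sequel to `ComplexTorusHodgeGroupSpecialLinear` (§10 `SquareAllDegrees`:
`H^{2q}_Hodge(X²) = 0` for `q ∉ {0, g, 2g}` when `Hg(X) = SL(V)`) through the tree's decomposition of the Néron–Severi group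
of a product, `ComplexTorusPicardNumberProduct` (`finrank_neronSeveriGroup_prod_eq_add_finrank_homRat_dual`:
`ρ(X₁ × X₂) = ρ(X₁) + ρ(X₂) + dim_ℚ Hom_ℚ(X₂, X̂₁)`, Hulek–Laface 2019, Prop. 2.2; `X̂ = ComplexTorus (dualPeriod Φ)`).
It complements, BY NAME, `ComplexTorusNotIsogenousToDual` (p12: Lange's §2.1.6 Exercise (9)(b) by an algebraically
independent period matrix, `exists_not_isIsogenous_dual`) and `ComplexTorusLazzeriJacobianCurve`
(`isIsomorphic_dual_self_of_finrank_eq_one`: every one-dimensional torus IS isomorphic to its dual) with the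
Hodge-theoretic criterion: EVERY complex torus of dimension `g ≥ 2` whose Hodge group is the full special linear group
(the general torus) has `Hom_ℚ(X, X̂) = 0`.

* `finrank_homRat_dual_eq_finrank_hodgeClasses_prod_sub` / `…_sq_sub` — **`dim_ℚ Hom_ℚ(X, X̂) = ρ(X × X) − 2ρ(X)`** for every
  complex torus; `homRat_dual_eq_bot_of_hodgeClasses_prod_one_eq_bot` — `H²_Hodge(X × X) = 0 ⟹ Hom_ℚ(X, X̂) = 0`.
* `homRat_dual_eq_bot_of_hodgeGroup_eq_top` — **`Hg(X) = SL(V)`, `g ≥ 2 ⟹ Hom_ℚ(X, X̂) = 0`** (`ρ(X²) = 0 = ρ(X)`);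
  `not_isIsogenous_dual_of_hodgeGroup_eq_top` (and `'`) — **`X ≁ X̂`** (the rational representation of an isogeny is a
  non-zero element of `Hom_ℚ(X, X̂)`, Lemma 1.1.11 / `isIsogeny_iff_det_ne_zero`); `hodgeGroup_dualPeriod_eq_top_iff` —
  `Hg(X̂) = SL ⟺ Hg(X) = SL` (`hodgeGroup_dual`: `Hg(X̂) = ᵗHg(X)⁻¹`), whence `homRat_dual_dual_eq_bot_of_hodgeGroup_eq_top`.
* (rider) `homRat_dualPeriod_dualPeriod_right` (`Hom_ℚ(Y, X̂̂) = Hom_ℚ(Y, X)`: `J_{X̂̂} = −ᵗ(−ᵗJ) = J`),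
  `homRat_dual_left_eq_bot_of_hodgeGroup_eq_top` — **`Hom_ℚ(X̂, X) = 0`**, `finrank_endAlgRat_prod_dual_of_hodgeGroup_eq_top` —
  **`dim_ℚ End_ℚ(X × X̂) = 2`** (`End_ℚ(X × X̂) = ℚ × ℚ` by the tree's `finrank_endAlgRat_prod_eq`), and the dual torus of a
  general torus is general: `endAlgRat_dual_eq_bot_of_hodgeGroup_eq_top`, `isSimple_dual_of_hodgeGroup_eq_top`,
  `hodgeClasses_dual_eq_bot_of_hodgeGroup_eq_top`, `not_isAbelianVariety_dual_of_hodgeGroup_eq_top`.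
* `not_isIsogenous_prod_dual_prod_self_of_hodgeGroup_eq_top` — **`X × X̂ ≁ X × X`**: `ρ(X × X̂) ≥ dim_ℚ End_ℚ(X̂) ≥ 1` (the
  Poincaré bundle) while `ρ(X × X) = 0`, and `ρ` is an isogeny invariant.

Sources: H. Lange, *Abelian Varieties over the Complex Numbers* (2023), §2.1.6 Exercise (9)(b) ("Conclude that there exists
a complex torus `X` not isogenous to its dual `X̂`."), §1.1.2 Prop. 1.1.6 / Lemma 1.1.11 (`Hom_ℚ` and the rational
representation), §1.4.5 Exercise (3) (`(X₁ × X₂)^ ≅ X̂₁ × X̂₂`), §7.2.2 Thm. 7.2.4 (p. 331: Hodge classes are the invariants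
of the Hodge group); K. Hulek, R. Laface, *On the Picard numbers of abelian varieties* (2019), §2.1 Prop. 2.2;
Green–Griffiths–Kerr 2012, §I.B (I.B.3).  THEOREMS ONLY (no definition, no named fact, net debt 0).

## References

* [cite: Lange2023AbelianVarietiesComplex, §2.1.6 Exercise (9)(b); §1.1.2 Prop. 1.1.6, Lemma 1.1.11; §1.4.5 Exercise (3); §7.2.2 Thm. 7.2.4 (p. 331); §7.3.3 Exercise (1)(a)]
* [cite: HulekLaface2019PicardNumbersAV, §2.1 Prop. 2.2, Cor. 2.3]
* [cite: GreenGriffithsKerr2012, §I.B (I.B.3)]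
-/

noncomputable section

open scoped Matrix

open Module Matrix Function

namespace Literature.Geometry.Kaehler.ComplexTorus

section DualHom

variable {ι : Type*} [Fintype ι] [DecidableEq ι] {E : Type*} [NormedAddCommGroup E] [NormedSpace ℂ E]
  (Φ : (ι → ℝ) ≃L[ℝ] E)

/-- **`dim_ℚ Hom_ℚ(X, X̂) = ρ(X × X) − 2ρ(X)`** for every complex torus `X` (Hulek–Laface's decomposition
`NS_ℚ(X₁ × X₂) ≅ NS_ℚ(X₁) ⊕ NS_ℚ(X₂) ⊕ Hom_ℚ(X₂, X̂₁)` with `X₁ = X₂ = X`, the tree's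
`finrank_neronSeveriGroup_prod_eq_add_finrank_homRat_dual`, and `ρ = dim_ℚ H²_Hodge`).
[cite: HulekLaface2019PicardNumbersAV, §2.1 Prop. 2.2] [cite: Lange2023AbelianVarietiesComplex, §1.4.5 Exercise (3) and §1.3.1 Exercise 1.3.4 (10)] -/
theorem finrank_homRat_dual_eq_finrank_hodgeClasses_prod_sub :
    finrank ℚ (homRat Φ (dualPeriod Φ)) =
      finrank ℚ (hodgeClasses (prodPeriod Φ Φ) 1) - 2 * finrank ℚ (hodgeClasses Φ 1) := by
  have h := finrank_neronSeveriGroup_prod_eq_add_finrank_homRat_dual Φ Φ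
  rw [finrank_neronSeveriGroup_eq_finrank_hodgeClasses, finrank_neronSeveriGroup_eq_finrank_hodgeClasses] at h
  omega

/-- The same with `X²` in place of `X × X` (`X × X ≅ X²`; `dim_ℚ H²_Hodge` is an isogeny invariant).
[cite: HulekLaface2019PicardNumbersAV, §2.1 Prop. 2.2] [cite: Lange2023AbelianVarietiesComplex, §7.3.3 Exercise (1)(a)] -/
theorem finrank_homRat_dual_eq_finrank_hodgeClasses_sq_sub :
    finrank ℚ (homRat Φ (dualPeriod Φ)) =
      finrank ℚ (hodgeClasses (powPeriod Φ 2) 1) - 2 * finrank ℚ (hodgeClasses Φ 1) := by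
  rw [finrank_homRat_dual_eq_finrank_hodgeClasses_prod_sub,
    ((IsIsogenous.refl Φ).prod_powPeriod_two (IsIsogenous.refl Φ)).finrank_hodgeClasses_eq _ _ 1]

/-- **`H²_Hodge(X × X) = 0 ⟹ Hom_ℚ(X, X̂) = 0`** (any complex torus): `Hom_ℚ(X, X̂)` is a direct summand of `NS_ℚ(X × X)`.
[cite: HulekLaface2019PicardNumbersAV, §2.1 Prop. 2.2] [cite: Lange2023AbelianVarietiesComplex, §1.4.5 Exercise (3)] -/
theorem homRat_dual_eq_bot_of_hodgeClasses_prod_one_eq_bot (h : hodgeClasses (prodPeriod Φ Φ) 1 = ⊥) :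
    homRat Φ (dualPeriod Φ) = ⊥ := by
  have h3 := finrank_homRat_dual_eq_finrank_hodgeClasses_prod_sub Φ
  rw [h, finrank_bot, Nat.zero_sub] at h3
  exact Submodule.finrank_eq_zero.1 h3

/-- **`Hg(X) = SL(V)`, `g ≥ 2 ⟹ Hom_ℚ(X, X̂) = 0`**: the general complex torus of dimension `≥ 2` admits no non-zero
homomorphism to its dual torus (`ρ(X²) = 0` by the Hodge classes of `X²` for `Hg = SL(V)` — §10 of
`ComplexTorusHodgeGroupSpecialLinear` — and `ρ(X) = 0`, so `dim_ℚ Hom_ℚ(X, X̂) = ρ(X²) − 2ρ(X) = 0`).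
[cite: Lange2023AbelianVarietiesComplex, §2.1.6 Exercise (9)(b) and §7.2.2 Thm. 7.2.4 (p. 331)] [cite: HulekLaface2019PicardNumbersAV, §2.1 Prop. 2.2] -/
theorem homRat_dual_eq_bot_of_hodgeGroup_eq_top [FiniteDimensional ℂ E] (h : hodgeGroup Φ = ⊤) (hg : 2 ≤ finrank ℂ E) :
    homRat Φ (dualPeriod Φ) = ⊥ := by
  have h1 : hodgeClasses (powPeriod Φ 2) 1 = ⊥ :=
    hodgeClasses_sq_eq_bot_of_hodgeGroup_eq_top Φ h one_ne_zero (by omega) (by omega)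
  have h2 : hodgeClasses Φ 1 = ⊥ :=
    hodgeClasses_one_eq_bot_of_hodgeGroup_eq_top Φ h (by rw [card_eq_two_mul_finrank Φ]; omega)
  have h3 := finrank_homRat_dual_eq_finrank_hodgeClasses_sq_sub Φ
  rw [h1, h2, finrank_bot, finrank_bot] at h3
  exact Submodule.finrank_eq_zero.1 (by simpa using h3)

/-- **`Hg(X) = SL(V)`, `g ≥ 2 ⟹ X IS NOT ISOGENOUS TO ITS DUAL `X̂`** (Lange §2.1.6 Exercise (9)(b): "there exists a complex torus
`X` not isogenous to its dual" — here: every torus with Hodge group `SL(V)` of dimension `≥ 2`): the rational representation of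
an isogeny `X → X̂` would be a non-zero element of `Hom_ℚ(X, X̂) = 0`.
[cite: Lange2023AbelianVarietiesComplex, §2.1.6 Exercise (9)(b) and §1.1.2 Prop. 1.1.6] -/
theorem not_isIsogenous_dual_of_hodgeGroup_eq_top [FiniteDimensional ℂ E] (h : hodgeGroup Φ = ⊤) (hg : 2 ≤ finrank ℂ E) :
    ¬ IsIsogenous Φ (dualPeriod Φ) := by
  rintro ⟨A, hA⟩
  have hmem := hA.map_intCast_mem_homRat
  rw [homRat_dual_eq_bot_of_hodgeGroup_eq_top Φ h hg, Submodule.mem_bot] at hmem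
  have hA0 : A = 0 := by
    ext i j
    have hij := congrFun (congrFun hmem i) j
    simpa using hij
  have hdet := ((isIsogeny_iff_det_ne_zero Φ (dualPeriod Φ) A).1 hA).2
  haveI : Nonempty ι := by
    rw [← Fintype.card_pos_iff, card_eq_two_mul_finrank Φ]
    omega
  rw [hA0, Matrix.det_zero] at hdet
  exact hdet rfl

/-- … nor is `X̂` isogenous to `X`. [cite: Lange2023AbelianVarietiesComplex, §2.1.6 Exercise (9)(b)] -/
theorem not_isIsogenous_dual_of_hodgeGroup_eq_top' [FiniteDimensional ℂ E] (h : hodgeGroup Φ = ⊤) (hg : 2 ≤ finrank ℂ E) :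
    ¬ IsIsogenous (dualPeriod Φ) Φ :=
  fun h' ↦ not_isIsogenous_dual_of_hodgeGroup_eq_top Φ h hg h'.symm

/-- **`Hg(X̂) = SL` iff `Hg(X) = SL`**: `Hg(X̂)(ℝ) = ᵗHg(X)(ℝ)⁻¹` (the tree's `hodgeGroup_dual`) and `M ↦ ᵗM⁻¹` is a bijection of
`SL(ℝ^ι)`. [cite: GreenGriffithsKerr2012, §I.B (I.B.3)] -/
theorem hodgeGroup_dualPeriod_eq_top_iff : hodgeGroup (dualPeriod Φ) = ⊤ ↔ hodgeGroup Φ = ⊤ := by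
  have hsurj : Surjective (contragredientSL ι) := fun A ↦ ⟨contragredientSL ι A, contragredientSL_contragredientSL A⟩
  rw [hodgeGroup_dual]
  constructor
  · intro h
    refine (Subgroup.eq_top_iff' _).2 fun M ↦ ?_
    have hM : contragredientSL ι M ∈ (hodgeGroup Φ).map (contragredientSL ι) := h ▸ Subgroup.mem_top _
    obtain ⟨N, hN, hNM⟩ := Subgroup.mem_map.1 hM
    rwa [← contragredientSL_injective hNM]
  · intro h
    rw [h, ← MonoidHom.range_eq_map, MonoidHom.range_eq_top.2 hsurj]

/-- **`Hg(X) = SL(V)`, `g ≥ 2 ⟹ Hom_ℚ(X̂, X̂̂) = 0`** (the dual torus is again a torus with Hodge group `SL`).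
[cite: Lange2023AbelianVarietiesComplex, §2.1.6 Exercise (9)(b)] [cite: GreenGriffithsKerr2012, §I.B (I.B.3)] -/
theorem homRat_dual_dual_eq_bot_of_hodgeGroup_eq_top [FiniteDimensional ℂ E] (h : hodgeGroup Φ = ⊤) (hg : 2 ≤ finrank ℂ E) :
    homRat (dualPeriod Φ) (dualPeriod (dualPeriod Φ)) = ⊥ := by
  haveI : FiniteDimensional ℝ (E →L⋆[ℂ] ℂ) := LinearEquiv.finiteDimensional (dualPeriod Φ).toLinearEquiv
  haveI : FiniteDimensional ℂ (E →L⋆[ℂ] ℂ) := Module.Finite.of_restrictScalars_finite ℝ ℂ _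
  exact homRat_dual_eq_bot_of_hodgeGroup_eq_top (dualPeriod Φ) ((hodgeGroup_dualPeriod_eq_top_iff Φ).2 h)
    (by rw [finrank_antidual Φ]; exact hg)

/-- **`X × X̂` IS NOT ISOGENOUS TO `X × X` for `Hg(X) = SL(V)`, `g ≥ 2`**: `ρ(X × X̂) = ρ(X) + ρ(X̂) + dim_ℚ End_ℚ(X̂) ≥ 1`
(the Poincaré bundle) while `ρ(X × X) = 0`, and the Picard number is an isogeny invariant.
[cite: HulekLaface2019PicardNumbersAV, §2.1 Prop. 2.2] [cite: Lange2023AbelianVarietiesComplex, §1.4.4 Thm. 1.4.10 and §7.3.3 Exercise (1)(a)] -/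
theorem not_isIsogenous_prod_dual_prod_self_of_hodgeGroup_eq_top [FiniteDimensional ℂ E] (h : hodgeGroup Φ = ⊤)
    (hg : 2 ≤ finrank ℂ E) : ¬ IsIsogenous (prodPeriod Φ (dualPeriod Φ)) (prodPeriod Φ Φ) := by
  intro hiso
  have h1 : finrank ℤ (neronSeveriGroup (prodPeriod Φ Φ)) = 0 := by
    rw [finrank_neronSeveriGroup_eq_finrank_hodgeClasses,
      ((IsIsogenous.refl Φ).prod_powPeriod_two (IsIsogenous.refl Φ)).finrank_hodgeClasses_eq _ _ 1,
      hodgeClasses_sq_eq_bot_of_hodgeGroup_eq_top Φ h one_ne_zero (by omega) (by omega), finrank_bot]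
  have h2 : 1 ≤ finrank ℤ (neronSeveriGroup (prodPeriod Φ (dualPeriod Φ))) := by
    rw [finrank_neronSeveriGroup_prod_eq_add_finrank_homRat_dual]
    have hone : (1 : Matrix ι ι ℚ) ∈ homRat (dualPeriod Φ) (dualPeriod Φ) :=
      (mem_homRat_self_iff (dualPeriod Φ) 1).2 (Subalgebra.one_mem _)
    haveI : Nonempty ι := by
      rw [← Fintype.card_pos_iff, card_eq_two_mul_finrank Φ]
      omega
    have hne : (1 : Matrix ι ι ℚ) ≠ 0 := one_ne_zero
    have h3 : 1 ≤ finrank ℚ (homRat (dualPeriod Φ) (dualPeriod Φ)) := by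
      calc 1 = finrank ℚ (ℚ ∙ (1 : Matrix ι ι ℚ)) := (finrank_span_singleton hne).symm
        _ ≤ finrank ℚ (homRat (dualPeriod Φ) (dualPeriod Φ)) :=
          Submodule.finrank_mono ((Submodule.span_singleton_le_iff_mem _ _).2 hone)
    omega
  have h3 := hiso.finrank_neronSeveriGroup_eq
  omega

/-! ### `Hom_ℚ(X̂, X) = 0` and `End_ℚ(X × X̂) = ℚ × ℚ` -/

omit [Fintype ι] in
/-- `Hom_ℚ(Y, X̂̂) = Hom_ℚ(Y, X)` on rational representations: the complex structure of the double dual in the double-dual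
lattice basis is `−ᵗ(−ᵗJ) = J` again (`X̂̂ = X` canonically, the identity on lattice coordinates).
[cite: Lange2023AbelianVarietiesComplex, §1.4.1 (`X̂̂ = X`)] -/
theorem homRat_dualPeriod_dualPeriod_right [Fintype ι] {ι' : Type*} [Fintype ι'] [DecidableEq ι'] {E' : Type*}
    [NormedAddCommGroup E'] [NormedSpace ℂ E'] (Ψ : (ι' → ℝ) ≃L[ℝ] E') :
    homRat Ψ (dualPeriod (dualPeriod Φ)) = homRat Ψ Φ := by
  ext B
  rw [mem_homRat_iff, mem_homRat_iff, jMatrix_dualPeriod, jMatrix_dualPeriod, Matrix.transpose_neg,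
    Matrix.transpose_transpose, neg_neg]

/-- **`Hg(X) = SL(V)`, `g ≥ 2 ⟹ Hom_ℚ(X̂, X) = 0`** as well (`X̂` is again general, and `Hom_ℚ(X̂, X̂̂) = Hom_ℚ(X̂, X)`).
[cite: Lange2023AbelianVarietiesComplex, §2.1.6 Exercise (9)(b) and §1.4.1] -/
theorem homRat_dual_left_eq_bot_of_hodgeGroup_eq_top [FiniteDimensional ℂ E] (h : hodgeGroup Φ = ⊤)
    (hg : 2 ≤ finrank ℂ E) : homRat (dualPeriod Φ) Φ = ⊥ := by
  rw [← homRat_dualPeriod_dualPeriod_right Φ (dualPeriod Φ)]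
  exact homRat_dual_dual_eq_bot_of_hodgeGroup_eq_top Φ h hg

/-- **`Hg(X) = SL(V)`, `g ≥ 2 ⟹ dim_ℚ End_ℚ(X × X̂) = 2`**: `End_ℚ(X × X̂) = End_ℚ(X) ⊕ Hom_ℚ(X̂, X) ⊕ Hom_ℚ(X, X̂) ⊕ End_ℚ(X̂)
= ℚ ⊕ 0 ⊕ 0 ⊕ ℚ` (`End_ℚ = ℚ` for a torus with `Hg = SL(V)`, the tree's `endAlgRat_eq_bot_of_hodgeGroupLie_eq_sl`).
[cite: Lange2023AbelianVarietiesComplex, §2.4.4 Cor. 2.4.26 (proof), p. 124, and §7.2.1 Prop. 7.2.3] -/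
theorem finrank_endAlgRat_prod_dual_of_hodgeGroup_eq_top [FiniteDimensional ℂ E] (h : hodgeGroup Φ = ⊤)
    (hg : 2 ≤ finrank ℂ E) : finrank ℚ (endAlgRat (prodPeriod Φ (dualPeriod Φ))) = 2 := by
  haveI : Nonempty ι := by
    rw [← Fintype.card_pos_iff, card_eq_two_mul_finrank Φ]
    omega
  have h₁ : endAlgRat Φ = ⊥ := endAlgRat_eq_bot_of_hodgeGroupLie_eq_sl Φ (hodgeGroupLie_eq_sl_of_hodgeGroup_eq_top Φ h)
  have h₂ : endAlgRat (dualPeriod Φ) = ⊥ :=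
    endAlgRat_eq_bot_of_hodgeGroupLie_eq_sl (dualPeriod Φ)
      (hodgeGroupLie_eq_sl_of_hodgeGroup_eq_top (dualPeriod Φ) ((hodgeGroup_dualPeriod_eq_top_iff Φ).2 h))
  rw [finrank_endAlgRat_prod_eq, homRat_dual_left_eq_bot_of_hodgeGroup_eq_top Φ h hg,
    homRat_dual_eq_bot_of_hodgeGroup_eq_top Φ h hg, h₁, h₂, finrank_bot, Subalgebra.finrank_bot]

/-! ### The dual torus of a general torus is general -/

/-- **`Hg(X) = SL(V) ⟹ End_ℚ(X̂) = ℚ`.** [cite: Lange2023AbelianVarietiesComplex, §7.2.1 Prop. 7.2.3 and §7.2.2 Prop. 7.2.5] [cite: GreenGriffithsKerr2012, §I.B (I.B.3)] -/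
theorem endAlgRat_dual_eq_bot_of_hodgeGroup_eq_top (h : hodgeGroup Φ = ⊤) : endAlgRat (dualPeriod Φ) = ⊥ :=
  endAlgRat_eq_bot_of_hodgeGroupLie_eq_sl (dualPeriod Φ)
    (hodgeGroupLie_eq_sl_of_hodgeGroup_eq_top (dualPeriod Φ) ((hodgeGroup_dualPeriod_eq_top_iff Φ).2 h))

/-- **`Hg(X) = SL(V) ⟹ X̂` is simple.** [cite: Lange2023AbelianVarietiesComplex, §7.2.2 Thm. 7.2.4] [cite: GreenGriffithsKerr2012, §I.B (I.B.3), (I.B.5)] -/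
theorem isSimple_dual_of_hodgeGroup_eq_top (h : hodgeGroup Φ = ⊤) : IsSimple (dualPeriod Φ) :=
  isSimple_of_hodgeGroup_eq_top (dualPeriod Φ) ((hodgeGroup_dualPeriod_eq_top_iff Φ).2 h)

/-- **`Hg(X) = SL(V) ⟹ H^{2p}_Hodge(X̂) = 0` for `0 < p < g`.** [cite: Lange2023AbelianVarietiesComplex, §7.2.2 Thm. 7.2.4 (p. 331)] [cite: GoodmanWallachGTM255, §5.5.2 Thm. 5.5.11] -/
theorem hodgeClasses_dual_eq_bot_of_hodgeGroup_eq_top (h : hodgeGroup Φ = ⊤) {p : ℕ} (hp : 0 < p)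
    (hp' : 2 * p < Fintype.card ι) : hodgeClasses (dualPeriod Φ) p = ⊥ :=
  hodgeClasses_eq_bot_of_hodgeGroup_eq_top (dualPeriod Φ) ((hodgeGroup_dualPeriod_eq_top_iff Φ).2 h) hp hp'

/-- **`Hg(X) = SL(V)`, `g ≥ 2 ⟹ X̂` is not an abelian variety** (no polarisation: `NS(X̂) = 0`).
[cite: Lange2023AbelianVarietiesComplex, §7.2.2 Thm. 7.2.4 and §4.1] -/
theorem not_isAbelianVariety_dual_of_hodgeGroup_eq_top [FiniteDimensional ℂ E] (h : hodgeGroup Φ = ⊤)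
    (hg : 2 ≤ finrank ℂ E) : ¬ IsAbelianVariety (dualPeriod Φ) := by
  haveI : FiniteDimensional ℝ (E →L⋆[ℂ] ℂ) := LinearEquiv.finiteDimensional (dualPeriod Φ).toLinearEquiv
  haveI : FiniteDimensional ℂ (E →L⋆[ℂ] ℂ) := Module.Finite.of_restrictScalars_finite ℝ ℂ _
  exact not_isAbelianVariety_of_hodgeGroup_eq_top ((hodgeGroup_dualPeriod_eq_top_iff Φ).2 h)
    (by rw [finrank_antidual Φ]; exact hg)

end DualHom

end Literature.Geometry.Kaehler.ComplexTorus
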